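import Summits.AtomisticToContinuum.HydrodynamicLimit.Theorems.JParityClosureLocalSecondLawRegularRangeReduction

/-!
# The pre-shock, guarded regular range F′ from `DensityCap` (by name) and a floors statement
(stmt-AtomisticToContinuum-13081, line `exact-entropy-ledger-three-passivities`, continuation lead c5)

F′ — the first input of the pre-shock composition `localSecondLawInBand_of_passivities_preShock`
(`Theorems/JParityClosureLocalSecondLawCompositionPreShock.lean`): for every cap `η₁` and guard level `0 < ηg < η₁`, in
the crux frame, for a classical solution whose reduced density stays below `ηg` on `[0,T)` and every horizon `τ < T`,
w.h.p. the orbit is good and the coarse fields keep `c ≤ ρ_r`, `ρ_r σ³ ≤ η₁`, `c ≤ θ_r` on `[0,τ] × 𝕋³` — splits into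
three thirds with three different producers, and two of them are available NOW:

* good orbit: the bad set of the flow is null for the local Gibbs law (`gridUp_localGibbsLaw_compl_good`, landed);
* cap: the route crux `JParityClosure.DensityCap` (stmt-AtomisticToContinuum-13082, BY NAME) at time `t := τ < T` and
  level `η := (η₁ − ηg)/σ³`, plus the packing guard `ρ σ³ < ηg` on `[0,T)`: off the overshoot event
  `ρ_r ≤ ρ + (η₁ − ηg)/σ³ < η₁/σ³` on `[0,τ] × 𝕋³` (the crux's `ρm` is `rhoC` definitionally);
* floors: the remaining DensityCap-class statement (no vacuum bubble, no cold populated ball before the shock; floor `c`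
  chosen before `r₀`), INLINED as the second hypothesis — lead c1's "CoarseRegularRange" minus its cap third; no producer
  on the board yet (to be filed by the planner with the restatement).

`regularRangePreShock_of_densityCap : DensityCap → Floors′ → F′` (texts verbatim those of the composition file).  So under the
restatement C′ the residue of the line reads {DensityCap (filed), Floors′, CoarseBounds2r′, Iso′, W′, Cubic′, CollisionalHeat′}
(`localSecondLawInBand_of_densityCap_preShock`, `…CompositionSixPreShock.lean`).

References: H. Spohn, *Large Scale Dynamics of Interacting Particles* (1991), Part I §3.
-/

noncomputable section

open scoped BigOperators Topology ENNReal InnerProductSpace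
open Filter Set MeasureTheory

namespace Summit.AtomisticToContinuum.HydrodynamicLimit.Theorems.LocalSecondLawLedger

open Literature.MathematicalPhysics.KineticTheory
open Literature.Analysis.FluidPDE
open Summit.AtomisticToContinuum.HydrodynamicLimit.Theses
open Summit.AtomisticToContinuum.HydrodynamicLimit.Theorems.LocalSecondLawNegative

variable {N : ℕ}

/-- The DensityCap vocabulary's mollified density IS the ledger's coarse density (both are `∫ b_r(q.1, x₀) dμ^N`,
same cone kernel; definitional). -/
theorem mollDensity_eq_rhoC (r : ℝ) (w : Phase N) (x₀ : T3) :
    DensityCapNegative.mollDensity r w x₀ = rhoC r w x₀ := rfl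

/-- **F′ from `DensityCap` and the floors** (`regularRangePreShock_of_densityCap`; see the module docstring).
Thresholds: `σ₀ := min`; given the data, `c` and `r_L` from the floors at `δ/2`, `r_D` from `DensityCap` at
`(t, η, δ) := (τ, (η₁ − ηg)/σ³, δ/2)`; `r₀ := min`, `N₀ := max`; event inclusion
`Regularᶜ ⊆ goodᶜ ∪ capEvent ∪ {floor violated}` and a union bound. -/
theorem regularRangePreShock_of_densityCap :
  JParityClosure.DensityCap → (∀ (a₀ θ₀ : T3 → ℝ) (u₀ : T3 → V3), Continuous a₀ → Continuous θ₀ → Continuous u₀ → (∀ x, 0 < a₀ x) → (∀ x, 0 < θ₀ x) → ∃ σ₀ : ℝ, 0 < σ₀ ∧ ∀ σ : ℝ, 0 < σ → σ < σ₀ → ∀ (T : ℝ) (ρ θ : ℝ → T3 → ℝ) (u : ℝ → T3 → V3), IsHardSphereEulerSolution σ T ρ u θ → ∀ Φ : (N : ℕ) → Flow σ N, TendstoHydroFieldsAt (fun N => localGibbsLaw σ a₀ u₀ θ₀ N (Φ N)) Φ ρ u θ 0 → 0 < T → ∀ τ : ℝ, 0 < τ → τ < T → ∀ δ : ℝ,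 0 < δ → ∃ c : ℝ, 0 < c ∧ ∃ r₀ : ℝ, 0 < r₀ ∧ ∀ r : ℝ, 0 < r → r < r₀ → ∃ N₀ : ℕ, ∀ N : ℕ, N₀ ≤ N → localGibbsLaw σ a₀ u₀ θ₀ N (Φ N) {z | ∃ s ∈ Set.Icc (0 : ℝ) τ, ∃ x : T3, rhoC r ((Φ N).flow s z) x < c ∨ thetaC r ((Φ N).flow s z) x < c} ≤ ENNReal.ofReal δ) → ∀ η₁ ηg : ℝ, 0 < ηg → ηg < η₁ → ∀ (a₀ θ₀ : T3 → ℝ) (u₀ : T3 → V3), Continuous a₀ → Continuous θ₀ → Continuous u₀ → (∀ x, 0 < a₀ x) → (∀ x, 0 < θ₀ x) → ∃ σ₀ : ℝ, 0 < σ₀ ∧ ∀ σ : ℝ, 0 < σ → σ < σ₀ → ∀ (T : ℝ) (ρ θ : ℝ → T3 → ℝ) (u : ℝ → T3 → V3), IsHardSphereEulerSolution σ T ρ u θ → (∀ t ∈ Set.Ico 0 T, ∀ x, ρ t x * σ ^ 3 < ηg) → ∀ Φ : (N : ℕ) → Flow σ N, TendstoHydroFieldsAt (fun N => localGibbsLaw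 σ a₀ u₀ θ₀ N (Φ N)) Φ ρ u θ 0 → 0 < T → ∀ τ : ℝ, 0 < τ → τ < T → ∀ δ : ℝ, 0 < δ → ∃ c : ℝ, 0 < c ∧ ∃ r₀ : ℝ, 0 < r₀ ∧ ∀ r : ℝ, 0 < r → r < r₀ → ∃ N₀ : ℕ, ∀ N : ℕ, N₀ ≤ N → localGibbsLaw σ a₀ u₀ θ₀ N (Φ N) {z | ¬ Regular σ r τ c η₁ (Φ N) z} ≤ ENNReal.ofReal δ := by
  intro hDC hFl η₁ ηg hηg hηglt a₀ θ₀ u₀ ha hθ hu ha0 hθ0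
  obtain ⟨σD, hσD, HD⟩ := DensityCapNegative.densityCap_iff.1 hDC a₀ θ₀ u₀ ha hθ hu ha0 hθ0
  obtain ⟨σL, hσL, HL⟩ := hFl a₀ θ₀ u₀ ha hθ hu ha0 hθ0
  refine ⟨min σD σL, lt_min hσD hσL, ?_⟩
  intro σ hσ hσlt T ρ θ u hE hguard Φ h0 hT τ hτ hτT δ hδ
  have hσD' : σ < σD := lt_of_lt_of_le hσlt (min_le_left _ _)
  have hσL' : σ < σL := lt_of_lt_of_le hσlt (min_le_right _ _)
  have hδ2 : 0 < δ / 2 := by positivity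
  have hσ3 : 0 < σ ^ 3 := pow_pos hσ 3
  have hηD : 0 < (η₁ - ηg) / σ ^ 3 := div_pos (sub_pos.2 hηglt) hσ3
  have hτIco : τ ∈ Set.Ico 0 T := ⟨hτ.le, hτT⟩
  -- floors at `δ/2` (they fix the floor `c` before the resolution)
  obtain ⟨c, hc, rL, hrL, HL'⟩ := HL σ hσ hσL' T ρ θ u hE Φ h0 hT τ hτ hτT (δ / 2) hδ2
  -- the density cap on `[0, τ]` at level `(η₁ - ηg)/σ³`, `δ/2`
  obtain ⟨rD, hrD, HD'⟩ := HD σ hσ hσD' T ρ θ u hE Φ h0 τ hτIco ((η₁ - ηg) / σ ^ 3) (δ / 2) hηD hδ2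
  refine ⟨c, hc, min rD rL, lt_min hrD hrL, ?_⟩
  intro r hr hrlt
  obtain ⟨ND, HND⟩ := HD' r hr (lt_of_lt_of_le hrlt (min_le_left _ _))
  obtain ⟨NL, HNL⟩ := HL' r hr (lt_of_lt_of_le hrlt (min_le_right _ _))
  refine ⟨max ND NL, fun N hN => ?_⟩
  have ED := HND N ((le_max_left _ _).trans hN)
  have EL := HNL N ((le_max_right _ _).trans hN)
  -- event inclusion
  have hsub : {z | ¬ Regular σ r τ c η₁ (Φ N) z} ⊆
      ((Φ N).goodᶜ ∪ DensityCapNegative.capEvent Φ N ρ τ ((η₁ - ηg) / σ ^ 3) r) ∪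
        {z | ∃ s ∈ Set.Icc (0 : ℝ) τ, ∃ x : T3,
          rhoC r ((Φ N).flow s z) x < c ∨ thetaC r ((Φ N).flow s z) x < c} := by
    intro z hz
    by_contra hcon
    simp only [Set.mem_union, Set.mem_compl_iff, DensityCapNegative.capEvent, Set.mem_setOf_eq, not_or,
      not_not, not_exists, not_and, not_lt] at hcon
    obtain ⟨⟨hgood, hcap⟩, hfl⟩ := hcon
    refine hz ⟨hgood, fun s hs x => ?_⟩
    have hfl' := hfl s hs x
    have hcap' : rhoC r ((Φ N).flow s z) x ≤ ρ s x + (η₁ - ηg) / σ ^ 3 := by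
      rw [← mollDensity_eq_rhoC]; exact hcap s hs x
    have hg : ρ s x * σ ^ 3 < ηg := hguard s ⟨hs.1, lt_of_le_of_lt hs.2 hτT⟩ x
    refine ⟨hfl'.1, ?_, hfl'.2⟩
    have h1 : rhoC r ((Φ N).flow s z) x * σ ^ 3 ≤ (ρ s x + (η₁ - ηg) / σ ^ 3) * σ ^ 3 :=
      mul_le_mul_of_nonneg_right hcap' hσ3.le
    have h2 : (ρ s x + (η₁ - ηg) / σ ^ 3) * σ ^ 3 = ρ s x * σ ^ 3 + (η₁ - ηg) := by
      field_simp
    linarith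
  calc localGibbsLaw σ a₀ u₀ θ₀ N (Φ N) {z | ¬ Regular σ r τ c η₁ (Φ N) z}
      ≤ localGibbsLaw σ a₀ u₀ θ₀ N (Φ N)
          (((Φ N).goodᶜ ∪ DensityCapNegative.capEvent Φ N ρ τ ((η₁ - ηg) / σ ^ 3) r) ∪
            {z | ∃ s ∈ Set.Icc (0 : ℝ) τ, ∃ x : T3,
              rhoC r ((Φ N).flow s z) x < c ∨ thetaC r ((Φ N).flow s z) x < c}) := measure_mono hsub
    _ ≤ localGibbsLaw σ a₀ u₀ θ₀ N (Φ N) ((Φ N).goodᶜ ∪ DensityCapNegative.capEvent Φ N ρ τ ((η₁ - ηg) / σ ^ 3) r) +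
        localGibbsLaw σ a₀ u₀ θ₀ N (Φ N)
            {z | ∃ s ∈ Set.Icc (0 : ℝ) τ, ∃ x : T3,
              rhoC r ((Φ N).flow s z) x < c ∨ thetaC r ((Φ N).flow s z) x < c} := measure_union_le _ _
    _ ≤ (localGibbsLaw σ a₀ u₀ θ₀ N (Φ N) (Φ N).goodᶜ +
          localGibbsLaw σ a₀ u₀ θ₀ N (Φ N) (DensityCapNegative.capEvent Φ N ρ τ ((η₁ - ηg) / σ ^ 3) r)) +
        localGibbsLaw σ a₀ u₀ θ₀ N (Φ N)
            {z | ∃ s ∈ Set.Icc (0 : ℝ) τ, ∃ x : T3,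
              rhoC r ((Φ N).flow s z) x < c ∨ thetaC r ((Φ N).flow s z) x < c} :=
        add_le_add (measure_union_le _ _) le_rfl
    _ ≤ (0 + ENNReal.ofReal (δ / 2)) + ENNReal.ofReal (δ / 2) :=
        add_le_add (add_le_add (le_of_eq (gridUp_localGibbsLaw_compl_good σ a₀ θ₀ u₀ N (Φ N))) ED) EL
    _ = ENNReal.ofReal δ := by rw [zero_add, ← ENNReal.ofReal_add hδ2.le hδ2.le, add_halves]

end Summit.AtomisticToContinuum.HydrodynamicLimit.Theorems.LocalSecondLawLedger

end
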